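import Summits.BirchSwinnertonDyer.Rank1Residual.GaloisImage.KolyvaginDeepFamily
import Summits.BirchSwinnertonDyer.Rank1Residual.GaloisImage.KuriharaLowerBoundThreeOfKolyvaginProductDeep
import Summits.BirchSwinnertonDyer.Rank1Residual.GaloisImage.KuriharaLowerBoundThreeOfKolyvaginProductCyclic
import Summits.BirchSwinnertonDyer.Rank1Residual.GaloisImage.KuriharaTowerPackaging
import Summits.BirchSwinnertonDyer.Rank1Residual.GaloisImage.KatoKuriharaPortThree
import Summits.BirchSwinnertonDyer.Rank1Residual.GaloisImage.TorsionReductionOfLe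
import Summits.BirchSwinnertonDyer.Rank1Residual.X4.OptimalPeriod
import Literature.NumberTheory.EllipticCurves.AgasheRibetStein2006.ManinConstantOptimalCurves
import Literature.NumberTheory.EllipticCurves.MordellWeilRankZeroProofs
import Literature.NumberTheory.EllipticCurves.ComplexMultiplicationBurungaleFlachProofs
import Literature.NumberTheory.EllipticCurves.AnalyticRankOrderProofs
import HarnessLib

/-!
# The RECORD-READY OUTPUT SHAPE of sub-route (a′) at `p = 3` on class A2 (DEEP side): Kurihara's
# LOWER half from a certificate at `n ∈ 𝒩_{k+t+1}`, the `3`-adic tower, the two S24-DEEP ports,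
# the Poitou–Tate families, `hEP`, ONE dictionary port
# (cell `b2b-bsdres`, team n1011, ROUTE-1 R1-53 E3 = §31.3; row T-R1-45 FILE E3; seat p18, deep
# glue = n1011-p15's draft (iii) `HOME/b2b-bsdres-n1011-p15/g3/drafts-for-R1-45/`, credit p15)

HONEST FRAMING (cell `b2b-bsdres`, run/shared/lean/b2b/bsd-rank1-residual/, verbatim in every
file): the goal of the cell is to DELETE the COMBINATION-SHAPED residual classes of the
Birch–Swinnerton-Dyer formula for ALL analytic-rank `≤ 1` elliptic curves over `ℚ` — "full BSD
formula for every rank `≤ 1` curve in class `C`" assembled STRICTLY from published theorems — so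
that the rank-`≤ 1` remainder becomes exactly the CONSTRUCTION-SHAPED classes, which are TYPED
(missing-input `Prop`s), NOT attempted. This is not "finishing BSD". Team n1011 (N10/N11, the
additive block `X4 ∧ p = 3`): research route; PER-PAIR record shape, NOT a class theorem; TOOL
theorems only (no definition, no named fact); nothing booked; no mark / label moved.  CONDITIONAL
on: the two S24-DEEP PORTS `hS24d`/`hS24d₂` (cc-typer-1 `KolyvaginDeepSubclass.lean`, flag
`S24-DEEP-PORT@3` — NOT the printed [S24] Thm. 4.4, which is the class-A1 file
`KuriharaRecordCorollaryThree.lean`), the Poitou–Tate families, Tate's `hEP`, and ONE typed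
dictionary PORT `KatoKuriharaPortThreeAt W t v₃` (FLAG `K22-Thm3.13-PORT@3`, the DICT3 debt line);
`hGZK`, modularity and `h26` as in every BSDp@3 record.  GUARD G-V1 (r1 §31.4 / referee-1 R-V1):
the statement carries `htj : t + j ≤ k + 1` with the certificate at modulus `3^j`, `1 ≤ j` — the
consumed value clause of the port is live.

## What and why

Planner r1 (ROUTE-1 §31.3, R1-53): E3 := n1011-p15's draft (iii)
`padicValRat_le_of_kolyvaginProduct_deepFamily` over F4 `S24Deep.exists_deepFamily_of_towerSurj`
(p281190) + F5 `Assembly.padicValRat_le_of_kolyvaginProduct_deep` (p280548, `c := k + t`), with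
`(hPort : KatoKuriharaPortThreeAt W t v₃)` in place of the inlined closure, `S := finSupport T` of
this seat's `TowerPackage.towerAdmissible` so that `hnS` is discharged, the flag in the records'
`hcyc` currency (`Assembly.natCard_torsionBy_reductionAt_le_of_dvd`), the reduction maps by
n1011-p11's `exists_torsionReduction_three`, and the optimal datum / GZK / modularity discharges of
E2.  ONE `τ` for all levels (`S24Deep.exists_tau_forall_levels_of_towerSurj`), so NO τ-input.

* `Assembly.exists_LOmega_padicValRat_le_of_towerSurj_deep` — `W/ℚ` globally minimal, ADDITIVE at
  `3` with `3 ∤ c₃`, the `3`-adic tower, `#E(ℚ₃)[3] = 3^t`, analytic rank `0`, an OPTIMAL datum at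
  `N ≤ 130000`; the two S24-DEEP ports; `inv` ×3, `inv′ k′` ×4; `hEP`; ONE `hPort`; a certificate at
  `n ∈ 𝒩_{k+t+1}(E,3)` (cyclicity flag, `ℓ ∤ N`, surjective `ψ ↠ ℤ/3^j`, `δ̃^{(j)}_n(ψ) ≠ 0`,
  `δ̃^{(j)}_d(ψ) = 0` for `1 < d < n`) with `t + j ≤ k + 1` ⟹
  `∃ q, L(E,1)/Ω(W) = q ∧ ord₃ q ≤ ord₃ #Ш(E)(3) + (j − 1)`.

The `BSDp W 3` endings through additive-p4's sockets are the sequel file (≤ 400-line rule).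

References: C.-H. Kim, AJM 148 (2026) Thm. 1.9 (6), Thm. 3.13 [Kim2022StructureSelmer]; R. Sakamoto,
JTNB 36 (2024) §2, Thm. 4.4 [Sakamoto2024]; B. Mazur, K. Rubin, Mem. AMS 799 (2004) §3.5 (H.5),
Thm. 3.2.4, Prop. A.2 [MazurRubin2004]; A. Agashe, K. Ribet, W. Stein (2006) Thm. 2.6
[AgasheRibetStein2006].
-/

noncomputable section

open scoped Classical NumberField ContRepresentation
open Function Field NumberField IsDedekindDomain IsDedekindDomain.HeightOneSpectrum WeierstrassCurve
  CongruenceSubgroup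
  Literature.NumberTheory.EllipticCurves Literature.NumberTheory.EllipticCurves.ModularForms
  Literature.NumberTheory.EllipticCurves.Rank1Residual
  Literature.NumberTheory.EllipticCurves.AgasheRibetStein2006
  Literature.NumberTheory.GaloisRepresentations
  Literature.NumberTheory.GaloisRepresentations.DiscreteGaloisModule Literature.NumberTheory.GaloisCohomology
  Rat.HeightOneSpectrum
  Summit.BirchSwinnertonDyer.Rank1Residual.X4

namespace Summit.BirchSwinnertonDyer.Rank1Residual.GaloisImage.Assembly

/-- **The OUTPUT SHAPE of (a′) at `p = 3` on class A2 (deep side), record-ready.**  `W/ℚ` globally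
minimal, ADDITIVE at `3` with `3 ∤ c₃`, the `3`-adic tower, `#E(ℚ₃)[3] = 3^t`, analytic rank `0`,
an OPTIMAL parametrisation datum `D` at a level `N ≤ 130000`; the two S24-DEEP PORTS
`hS24d`/`hS24d₂`, the Poitou–Tate family `inv` at `3` (three properties) and `inv′ k′` at every
`3^{k′+1}` (four properties), Tate's `hEP`, GZK, modularity, `h26`; ONE dictionary port
`KatoKuriharaPortThreeAt W t v₃`; a depth `k` and a modulus exponent `j` with `t + j ≤ k + 1`
(GUARD G-V1); and a CERTIFICATE at `n ∈ 𝒩_{k+t+1}(E,3)` with the cyclicity flag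
`#(E₀ mod ℓ)(𝔽_ℓ)[3] ≤ 3` at its primes, `ℓ ∤ N` for `ℓ ∣ n`, surjective `ψ ↠ ℤ/3^j`,
`δ̃^{(j)}_n(ψ) ≠ 0` and `δ̃^{(j)}_d(ψ) = 0` for `1 < d < n`, `d ∣ n`.  THEN
`∃ q, L(E,1)/Ω(W) = q ∧ ord₃ q ≤ ord₃ #Ш(E)(3) + (j − 1)`.  Every ∀k′ family of F5 is discharged
inside by p15's F4 (the shallow datum is the family's member `k`, class exponent `k + t` as (B6)
prescribes); nothing else is assumed.  (Deep glue: n1011-p15's draft (iii), credit p15.)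
[cite: Kim2022StructureSelmer, Thm. 1.9 (6) and Thm. 3.13] [cite: Sakamoto2024, Thm. 4.4 (p. 926)]
[cite: MazurRubin2004, §3.5 (H.5) (p. 27) and Prop. A.2 (pp. 79–80)] [cite: AgasheRibetStein2006, Thm. 2.6 (p. 619)] -/
theorem exists_LOmega_padicValRat_le_of_towerSurj_deep
    (hS24d : S24Deep.kolyvaginSystems_freeRankOne_zmod_three_pow_deep)
    (hS24d₂ : S24Deep.kolyvaginSystems_idealOfBasis_eq_fittingIdeal_zmod_three_pow_deep)
    (hGZK : rank_eq_analyticRank_of_analyticRank_le_one) (hmod : hasEntireLFunction_rat)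
    (h26 : cremona_abs_maninConstant_eq_one_of_level_le)
    (W : WeierstrassCurve ℚ) [W.IsElliptic] [W.IsGloballyMinimal] (t k : ℕ)
    -- the row
    (hadd : haveI : Fact (Nat.Prime 3) := ⟨Nat.prime_three⟩; Addv W 3)
    (hc3 : ¬ 3 ∣ (W.baseChange ℚ_[3]).localTamagawaNumber ℤ_[3])
    (htower : ∀ m : ℕ, W.HasSurjectiveModNGaloisRep (3 ^ m : ℕ))
    (ht : Nat.card {Q : (W.baseChange ℚ_[3]).toAffine.Point // (3 : ℕ) • Q = 0} = 3 ^ t)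
    (hr : W.analyticRank = 0)
    {N : ℕ} [NeZero N] (hN : N ≤ 130000) (D : ModularParametrizationData W N)
    (hopt : ∀ z ∈ D.L.lattice, ∃ w ∈ periodLattice D.f, z = D.c * w)
    -- the Poitou–Tate families and Tate's local Euler characteristic
    (inv : LocalInvariants ℚ 3) (hperf : inv.IsPerfect) (hsum : inv.SumLocalTermEqZero)
    (hcompl : inv.SelmerComplement)
    (inv' : ∀ k' : ℕ, LocalInvariants ℚ (3 ^ (k' + 1))) (hperf' : ∀ k', (inv' k').IsPerfect)
    (hsum' : ∀ k', (inv' k').SumLocalTermEqZero) (hcompl' : ∀ k', (inv' k').SelmerComplement)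
    (hinj' : ∀ k', ∀ v : HeightOneSpectrum (𝓞 ℚ), Injective (inv' k' (Sum.inr v)))
    (hEP : ∀ v : HeightOneSpectrum (𝓞 ℚ), localEulerPoincareCharacteristic (v.adicCompletion ℚ))
    -- ONE dictionary port
    (v₃ : HeightOneSpectrum (𝓞 ℚ)) (hv₃ : ((3 : ℕ) : 𝓞 ℚ) ∈ v₃.asIdeal)
    (hPort : KatoKuriharaPortThreeAt W t v₃)
    -- the certificate at `n ∈ 𝒩_{k+t+1}`, modulus `3^j`, `t + j ≤ k + 1`
    (n : ℕ) [NeZero n] (hn : Kato.IsKolyvaginProduct W 3 (k + t + 1) n)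
    (hcyc : ∀ (ℓ : ℕ) [Fact ℓ.Prime], ℓ ∣ n →
      Nat.card {P : ((integralModelInt W).map (Int.castRingHom (ZMod ℓ))).toAffine.Point //
        3 • P = 0} ≤ 3)
    (hnN : ∀ ℓ ∈ n.primeFactors, ¬ ℓ ∣ N) {j : ℕ} (htj : t + j ≤ k + 1)
    (ψ : (ℓ : ℕ) → (ZMod ℓ)ˣ →* Multiplicative (ZMod (3 ^ j)))
    (hψ : ∀ ℓ ∈ n.primeFactors, Function.Surjective (ψ ℓ))
    (hcert : kuriharaNumber D.f (3 ^ j) n ψ ≠ 0)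
    (hv : ∀ d : ℕ, d ∣ n → 1 < d → d < n → ∀ [NeZero d], kuriharaNumber D.f (3 ^ j) d ψ = 0) :
    ∃ q : ℚ, W.entireLFunction 1 / (W.realPeriodRat : ℂ) = (q : ℂ) ∧
      padicValRat 3 q ≤
        (padicValNat 3 (Nat.card (AddCommGroup.primaryComponent W.sha 3)) : ℤ) + ((j - 1 : ℕ) : ℤ) := by
  haveI : Fact (Nat.Prime 3) := ⟨Nat.prime_three⟩
  -- the row: `L(E,1) ≠ 0`, `E(ℚ)` and `Ш` finite, surj(3)
  have hL : W.entireLFunction 1 ≠ 0 := by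
    rw [← W.leadingLCoeff_eq_of_analyticRank_eq_zero hr]
    exact W.leadingLCoeff_ne_zero_holds (hmod W)
  have hGZ := hGZK W (by rw [hr]; exact zero_le_one)
  haveI : Finite W.sha := hGZ.2
  haveI : Finite W.toAffine.Point := W.mordellWeilRank_eq_zero_iff_holds.mp (by rw [hGZ.1, hr])
  have hsurj : W.HasSurjectiveModNGaloisRep ((3 : ℕ) : ℤ) := by simpa using htower 1
  -- the optimal datum: `3 ∤ c_D`, the period transfer
  have hcD : ¬ (3 : ℤ) ∣ D.maninConstant := not_dvd_maninConstant_of_level_le h26 W D hopt hN Nat.prime_three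
  have hper : ∃ u : ℚ, ‖(u : ℚ_[3])‖ = 1 ∧ W.realPeriodRat = u * plusPeriod D.f :=
    periodTransfer_of_optimal 3 D hopt hcD
  have hcP : ¬ ((3 : ℕ) : ℤ) ∣ D.maninConstant := by exact_mod_cast hcD
  -- the admissible set `T = {v ∣ 3} ∪ {bad}` and `S = S(T)`
  obtain ⟨T, h3T, hbadT, hTmem, hT, h𝓕T, h𝓚T, hfinT, hfinS⟩ := TowerPackage.towerAdmissible W
  have hS : ∀ w : InfinitePlace ℚ, (Sum.inl w : Place ℚ) ∈ finSupport T := inl_mem_finSupport T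
  have h3S : ∀ v : HeightOneSpectrum (𝓞 ℚ), ((3 : ℕ) : 𝓞 ℚ) ∈ v.asIdeal →
      (Sum.inr v : Place ℚ) ∈ finSupport T := fun v hv => (inr_mem_finSupport_iff T v).mpr (h3T v hv)
  have hbadS : ∀ v : HeightOneSpectrum (𝓞 ℚ), ¬ W.HasGoodReductionAt v →
      (Sum.inr v : Place ℚ) ∈ finSupport T := fun v hv => (inr_mem_finSupport_iff T v).mpr (hbadT v hv)
  have hSgood : ∀ v ∉ {v : HeightOneSpectrum (𝓞 ℚ) | (Sum.inr v : Place ℚ) ∈ finSupport T},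
      W.HasGoodReductionAt v ∧ ((3 : ℕ) : 𝓞 ℚ) ∉ v.asIdeal := fun v hv =>
    ⟨by_contra fun h => hv (hbadS v h), fun h => hv (h3S v h)⟩
  -- ONE `τ` for all levels, and the deep family (p15 F4)
  obtain ⟨τ, hτμ, hτq⟩ := S24Deep.exists_tau_forall_levels_of_towerSurj W htower
  obtain ⟨η, D', g', hP', hDT', hD', hPP', hPS', hUT', hg', hgo', hgen', hR22'⟩ :=
    S24Deep.exists_deepFamily_of_towerSurj W hS24d hS24d₂ t k htower τ hτμ hτq inv hperf hsum hcompl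
      hEP (finSupport T) hS h3S hbadS hfinT
  -- the reduction maps (p11)
  choose red hred using fun k' => exists_torsionReduction_three W k k'
  -- the guards: the member `k′` lies in the class of exponent `max k k′ + t ⊇`-wise below `k′ + t`
  have hguard : ∀ k' m, m ≤ max k k' + t → (D' k').IsCanonicalTauDatumThreeAt W m k' :=
    fun k' m hm => ⟨hDT' k', ⟨η k', hD' k'⟩, _, τ, hSgood, hτμ _, hτq _, (hP' k').le.trans
      (S24Deep.frobeniusClassPrimes_torsion_pow_mul_mono W ((3 : ℕ) : ℤ) hm _ τ
        (pow_dvd_pow 3 (by omega)))⟩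
  have hdict := hPort.dictionary₂ (hguard k (k + t) (by omega)) (fun k' => hguard k' (k' + t) (by omega))
    red
  -- surjectivity at the class level `3^{k+t+1}` from the tower
  have hsurjK : W.HasSurjectiveModNGaloisRep (((3 : ℕ) : ℤ) ^ (max k k + t) * ((3 : ℕ) : ℤ)) := by
    simpa only [Nat.cast_pow, Nat.cast_mul, pow_succ] using htower (max k k + t + 1)
  have hn' : Kato.IsKolyvaginProduct W 3 (max k k + t + 1) n := by rw [max_self]; exact hn
  -- F5 with everything discharged
  exact padicValRat_le_of_kolyvaginProduct_deep W t k (max k k + t) (D' k) v₃ hv₃ hadd hc3 hsurj ht hL D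
    hcP hper (hDT' k) (g' k) (hg' k) (hgen' k) D' hDT' hPP' red hred hdict g' hg' hgo' hgen' inv' hperf'
    hsum' hcompl' hinj' hEP (fun _ => T) (fun _ => h3T v₃ hv₃) hT h𝓕T h𝓚T hfinT hfinS
    (fun q hq => fun h => hPS' k q hq ((inr_mem_finSupport_iff T q).mpr h))
    (fun k' q hq => fun h => hPS' k' q hq ((inr_mem_finSupport_iff T q).mpr h))
    (hUT' k) hUT'
    (fun d hd => hR22' k (inv' k) (hperf' k) (hsum' k) (hcompl' k) d hd)
    (fun k' d hd => hR22' k' (inv' k') (hperf' k') (hsum' k') (hcompl' k') d hd)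
    (hτμ _) (hτq _) (hP' k) hsurjK n hn'
    (fun v hv => natCard_torsionBy_reductionAt_le_of_dvd W 3 hcyc hv)
    (fun v hv h => by
      obtain ⟨hgood, h3⟩ := hasGoodReductionAt_and_not_mem_of_kolyvaginProduct W 3 hn hv
      rcases hTmem v ((inr_mem_finSupport_iff T v).mp h) with hbad | h3v
      · exact hbad hgood
      · exact h3 h3v)
    hnN htj ψ hψ hcert hv

end Summit.BirchSwinnertonDyer.Rank1Residual.GaloisImage.Assembly

end
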